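import Literature.Probability.Percolation.BlockExplorationBasic
import Literature.Probability.LatticeModels.RandomClusterRimWiringEvents
import HarnessLib

/-!
# Nested explorations: the one-level chain decomposition of the inside piece (proved)

Topic `Literature/Probability/LatticeModels`; companion of
`Literature/Probability/Percolation/BlockExploration*.lean` (the exploration `𝒞 = explSet`,
`𝒟 = explRim`, datum event `explEvent In Blk U R = {𝒞 = U, 𝒟 = R}` of D. Basu, A. Sapozhnikov,
ECP 22 (2017), §2) and of `RandomClusterRimWiring*.lean` (domain Markov property of the
random-cluster measure at an explored set whose rim is wired from inside).

Kesten's ratio-limit scheme (H. Kesten, PTRF 73 (1986), proof of Thm. 3, eqs. (16)–(19); in the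
planarity-free form of Basu–Sapozhnikov, §2, eqs. (2.4)–(2.6)) iterates the decomposition of a
connection at a CHAIN of explored sets. One level of the chain: an inner datum `(U', R')`
(explored set `U'`, rim `R'`, the rim WIRED through `U'`) sits inside an outer explored set
`U ⊇ U' ∪ R'` with outer rim `R` (disjoint from `U' ∪ R'`), and the anchor `x` lies in `U'`.

* `insidePiece_iff_of_nested_explEvent` (combinatorics): "`x` is joined inside `U` to a vertex
  carrying an open edge to `R`" holds iff (inner piece) `x` is joined inside `U'` to a vertex
  carrying an open edge to `R'` AND (middle piece) some inner-rim vertex is joined inside `U ∖ U'`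
  to a vertex carrying an open edge to `R` — first exit from / last visit to `U'` of the open path,
  glued back through the wired inner rim.
* `explEvent_wired_rimHyps` (hypotheses of the Markov bricks): on a finite graph `G`, the
  saturated datum event `{ω | ω ∩ E(G) ∈ {𝒞 = U', 𝒟 = R'} ∩ {rim wired through U'}}` is
  determined by the `G`-edges `T` touching `U'`, its open `T`-edges leave `U'` only into `R'`, and
  `R'` is pairwise joined by open `T`-edges — exactly the three hypotheses under which
  `RandomClusterRimWiring*.lean` factorises the random-cluster measure at `U'`.

Everything is proved; no definitions.

## References
* [BasuSapozhnikov2017ECP] D. Basu, A. Sapozhnikov, *Kesten's incipient infinite cluster and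
  quasi-multiplicativity of crossing probabilities*, Electron. Commun. Probab. 22 (2017) no. 26,
  §2, eqs. (2.4)–(2.6).
* [Kesten1986] H. Kesten, The incipient infinite cluster in two-dimensional percolation,
  *Probab. Theory Related Fields* 73 (1986) 369–394, proof of Thm. 3, eqs. (16)–(19).
-/

open MeasureTheory Finset SimpleGraph
open Literature.Probability.Percolation (BondConfig openConnIn openGraph explSet explRim explEvent explRimWired)

namespace Literature.Probability.LatticeModels

/-- **One level of Kesten's chain: decomposition of the inside piece at a nested datum.** Let
`ω ∈ explEvent In' Blk' U' R'` have its rim wired through `U'`, let `U ⊇ U'` with `R' ⊆ U`, let `R`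
miss `U' ∪ R'`, and let `x ∈ U'`. Then `x` is joined inside `U` to a vertex carrying an open edge to
`R` iff (i) `x` is joined inside `U'` to a vertex carrying an open edge to `R'` (the piece before the
FIRST exit from `U'`: an open edge leaving `U'` ends in `R'`) and (ii) some `w'' ∈ R'` is joined inside
`U ∖ U'` to a vertex carrying an open edge to `R` (the piece after the LAST visit to `U'`);
conversely the two pieces are glued, inside `U`, through the wired inner rim.
[cite: BasuSapozhnikov2017ECP, §2 (eq. (2.4)–(2.6))] -/
theorem insidePiece_iff_of_nested_explEvent :
    ∀ {V : Type*} {In' Blk' U' R' U R : Set V} {ω : Literature.Probability.Percolation.BondConfig V}, ω ∈ Literature.Probability.Percolation.explEvent In' Blk' U' R' → (∀ r ∈ R', ∀ r₂ ∈ R', ∃ v ∈ U', ∃ v' ∈ U', s(v, r) ∈ ω ∧ s(v', r₂) ∈ ω ∧ ω ∈ Literature.Probability.Percolation.openConnIn U' v v') → U' ⊆ U → R' ⊆ U → (∀ r ∈ R, r ∉ U' ∧ r ∉ R') → ∀ {x : V}, x ∈ U' → ((∃ w ∈ R, ∃ v ∈ U, ω ∈ Literature.Probability.Percolation.openConnIn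 U x v ∧ s(v, w) ∈ ω) ↔ (∃ w' ∈ R', ∃ v' ∈ U', ω ∈ Literature.Probability.Percolation.openConnIn U' x v' ∧ s(v', w') ∈ ω) ∧ ∃ w'' ∈ R', ∃ v ∈ U, ∃ w ∈ R, ω ∈ Literature.Probability.Percolation.openConnIn (U \ U') w'' v ∧ s(v, w) ∈ ω) := by
  intro V In' Blk' U' R' U R ω hω hwired hU'U hR'U hR x hx
  -- `U'` is the explored set and `R'` the rim of `ω`: they are disjoint
  have hdisj : ∀ {a b : V}, a ∈ U' → b ∈ R' → a ≠ b := by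
    obtain ⟨h1, h2⟩ := Percolation.mem_explEvent_iff.1 hω
    rintro a b ha hb rfl
    rw [← h1] at ha
    rw [← h2] at hb
    exact (Percolation.mem_explRim_iff.1 hb).1 ha
  constructor
  · rintro ⟨w, hw, v, hv, hxv, hvw⟩
    -- the target `v` is not in `U'`: an open edge from `U'` ends in `U' ∪ R'`, which `w` misses
    have hvU' : v ∉ U' := fun hvU' =>
      (hR w hw).2 (Percolation.mem_of_mem_explEvent_of_open_edge hω hvU' hvw (hR w hw).1)
    rw [Percolation.mem_openConnIn_iff_pathIn] at hxv
    constructor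
    · -- the piece before the FIRST exit from `U'`; the exit edge ends in the inner rim
      obtain ⟨a, b, ha, hb, -, hab, hxa⟩ := hxv.exit hx hvU'
      rw [Percolation.openGraph_adj] at hab
      refine ⟨b, Percolation.mem_of_mem_explEvent_of_open_edge hω ha hab.1 hb, a, ha, ?_, hab.1⟩
      rw [Percolation.mem_openConnIn_iff_pathIn]
      exact hxa.mono Set.inter_subset_left
    · -- the piece after the LAST visit to `U'`; it starts at an inner-rim vertex
      obtain ⟨a, b, ha, -, hb, hab, hbv⟩ := hxv.last_exit hx hvU'
      rw [Percolation.openGraph_adj] at hab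
      refine ⟨b, Percolation.mem_of_mem_explEvent_of_open_edge hω ha hab.1 hb, v, hv, w, hw, ?_,
        hvw⟩
      rw [Percolation.mem_openConnIn_iff_pathIn]
      exact hbv
  · rintro ⟨⟨w', hw', v', hv', hxv', hv'w'⟩, w'', hw'', v, hv, w, hw, hw''v, hvw⟩
    -- glue `x ~ v' — w' — v₁ ~ v₂ — w'' ~ v` inside `U` through the wired inner rim
    obtain ⟨v₁, hv₁, v₂, hv₂, hv₁w', hv₂w'', hv₁v₂⟩ := hwired w' hw' w'' hw''
    have mono : ∀ {S : Set V} {a b : V}, S ⊆ U → ω ∈ openConnIn S a b → ω ∈ openConnIn U a b :=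
      fun hS h => Percolation.openConnIn_mono hS _ _ h
    refine ⟨w, hw, v, hv, ?_, hvw⟩
    exact Percolation.PlanarDuality.openConnIn_trans (mono hU'U hxv')
      (Percolation.PlanarDuality.openConnIn_trans
        (Percolation.openConnIn_of_adj (hU'U hv') (hR'U hw') hv'w' (hdisj hv' hw'))
        (Percolation.PlanarDuality.openConnIn_trans
          (Percolation.openConnIn_reverse
            (Percolation.openConnIn_of_adj (hU'U hv₁) (hR'U hw') hv₁w' (hdisj hv₁ hw')))
          (Percolation.PlanarDuality.openConnIn_trans (mono hU'U hv₁v₂)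
            (Percolation.PlanarDuality.openConnIn_trans
              (Percolation.openConnIn_of_adj (hU'U hv₂) (hR'U hw'') hv₂w'' (hdisj hv₂ hw''))
              (mono (fun _ hz => hz.1) hw''v)))))

/-- **The saturated wired datum event satisfies the hypotheses of the rim-wiring Markov
property.** On a finite graph `G`, let `T` be the set of `G`-edges touching `U'` and
`F = {ω | ω ∩ E(G) ∈ explEvent In' Blk' U' R' ∩ {rim wired through U'}}`. Then (1) `F` is
determined by `ω ∩ T` (two configurations agreeing on `T` agree, once intersected with `E(G)`, on
every pair touching `U'`, and the datum event and the wiring clause only look at such pairs);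
(2) an open `T`-edge of a configuration of `F` leaves `U'` only into `R'`; (3) any two vertices of
`R'` are joined in `fromEdgeSet (ω ∩ T)` (two attachment edges and an open path inside `U'`, all of
them open `G`-edges touching `U'`). [cite: Kesten1986, proof of Thm. 3, eqs. (16)–(19)] -/
theorem explEvent_wired_rimHyps :
    ∀ {V : Type*} [Fintype V] [DecidableEq V] (G : SimpleGraph V) [DecidableRel G.Adj] (In' Blk' : Set V) (U' R' : Set V) (T : Finset (Sym2 V)), (∀ e, e ∈ T ↔ e ∈ G.edgeFinset ∧ ∃ v ∈ U', v ∈ e) → let F : Set (Literature.Probability.Percolation.BondConfig V) := {ω | ω ∩ (↑G.edgeFinset : Set (Sym2 V)) ∈ Literature.Probability.Percolation.explEvent In' Blk' U' R' ∩ {ω | ∀ r ∈ R', ∀ r₂ ∈ R', ∃ v ∈ U', ∃ v' ∈ U', s(v, r) ∈ ω ∧ s(v', r₂) ∈ ω ∧ ω ∈ Literature.Probability.Percolation.openConnIn U' v v'}}; (∀ ω₁ ω₂ : Literature.Probability.Percolation.BondConfig V, ω₁ ∩ ↑T = ω₂ ∩ ↑T → (ω₁ ∈ F ↔ ω₂ ∈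 F)) ∧ (∀ ω ∈ F, ∀ e ∈ ω, e ∈ T → ∀ x ∈ e, x ∉ U' → x ∈ R') ∧ (∀ ω ∈ F, ∀ x ∈ R', ∀ y ∈ R', (SimpleGraph.fromEdgeSet (ω ∩ ↑T)).Reachable x y) := by
  intro V _ _ G _ In' Blk' U' R' T hT F
  -- an open `G`-edge issuing from `U'` is an open `T`-edge
  have hsub : ∀ (ω : BondConfig V), ∀ a ∈ U', ∀ b : V,
      s(a, b) ∈ ω ∩ (↑G.edgeFinset : Set (Sym2 V)) → s(a, b) ∈ ω ∩ (↑T : Set (Sym2 V)) :=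
    fun ω a ha b hab => ⟨hab.1, (hT _).2 ⟨hab.2, a, ha, Sym2.mem_mk_left a b⟩⟩
  -- the wiring clause passes between configurations agreeing on the pairs touching `U'`
  have hwire : ∀ {ωa ωb : BondConfig V},
      (∀ e : Sym2 V, (∃ v ∈ U', v ∈ e) → (e ∈ ωa ↔ e ∈ ωb)) →
      (∀ r ∈ R', ∀ r₂ ∈ R', ∃ v ∈ U', ∃ v' ∈ U',
        s(v, r) ∈ ωa ∧ s(v', r₂) ∈ ωa ∧ ωa ∈ openConnIn U' v v') →
      ∀ r ∈ R', ∀ r₂ ∈ R', ∃ v ∈ U', ∃ v' ∈ U',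
        s(v, r) ∈ ωb ∧ s(v', r₂) ∈ ωb ∧ ωb ∈ openConnIn U' v v' := by
    intro ωa ωb hag h r hr r₂ hr₂
    obtain ⟨v, hv, v', hv', h1, h2, h3⟩ := h r hr r₂ hr₂
    exact ⟨v, hv, v', hv', (hag _ ⟨v, hv, Sym2.mem_mk_left v r⟩).1 h1,
      (hag _ ⟨v', hv', Sym2.mem_mk_left v' r₂⟩).1 h2,
      Percolation.BlockExploration.openConnIn_of_agree h3 fun a ha b _ hab =>
        (hag _ ⟨a, ha, Sym2.mem_mk_left a b⟩).1 hab⟩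
  refine ⟨fun ω₁ ω₂ h12 => ?_, fun ω hω e he heT x hxe hxU' => ?_, fun ω hω x hx y hy => ?_⟩
  · -- (1) the saturated configurations agree on every pair touching `U'`
    have hag : ∀ e : Sym2 V, (∃ v ∈ U', v ∈ e) →
        (e ∈ ω₁ ∩ (↑G.edgeFinset : Set (Sym2 V)) ↔ e ∈ ω₂ ∩ (↑G.edgeFinset : Set (Sym2 V))) := by
      intro e he
      by_cases heE : e ∈ G.edgeFinset
      · have heT : e ∈ T := (hT e).2 ⟨heE, he⟩
        have h : e ∈ ω₁ ∩ (↑T : Set (Sym2 V)) ↔ e ∈ ω₂ ∩ (↑T : Set (Sym2 V)) := by rw [h12]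
        simp only [Set.mem_inter_iff, Finset.mem_coe, heT, and_true] at h
        simp only [Set.mem_inter_iff, Finset.mem_coe, heE, and_true]
        exact h
      · simp only [Set.mem_inter_iff, Finset.mem_coe, heE, and_false]
    show ω₁ ∩ ↑G.edgeFinset ∈ explEvent In' Blk' U' R' ∩ _ ↔
      ω₂ ∩ ↑G.edgeFinset ∈ explEvent In' Blk' U' R' ∩ _
    rw [Set.mem_inter_iff, Set.mem_inter_iff,
      Percolation.mem_explEvent_iff_of_agree_on_touching hag]
    exact and_congr_right fun _ => ⟨hwire hag, hwire fun e he => (hag e he).symm⟩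
  · -- (2) an open `T`-edge `e = {v, x}` with `v ∈ U'`, `x ∉ U'` ends in the rim
    obtain ⟨heE, v, hv, hve⟩ := (hT e).1 heT
    have hvx : v ≠ x := fun h => hxU' (h ▸ hv)
    obtain rfl : e = s(v, x) := (Sym2.mem_and_mem_iff hvx).1 ⟨hve, hxe⟩
    exact Percolation.mem_of_mem_explEvent_of_open_edge hω.1 hv ⟨he, heE⟩ hxU'
  · -- (3) `x — v ~ v' — y` along open `T`-edges
    obtain ⟨hωE, hωW⟩ := hω
    obtain ⟨v, hv, v', hv', hvx, hv'y, hvv'⟩ := hωW x hx y hy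
    have hdisj : ∀ {a b : V}, a ∈ U' → b ∈ R' → a ≠ b := by
      obtain ⟨h1, h2⟩ := Percolation.mem_explEvent_iff.1 hωE
      rintro a b ha hb rfl
      rw [← h1] at ha
      rw [← h2] at hb
      exact (Percolation.mem_explRim_iff.1 hb).1 ha
    have hadj : ∀ {a b : V}, a ∈ U' → b ∈ R' → s(a, b) ∈ ω ∩ (↑G.edgeFinset : Set (Sym2 V)) →
        (fromEdgeSet (ω ∩ (↑T : Set (Sym2 V)))).Adj a b := fun ha hb hab => by
      rw [fromEdgeSet_adj]
      exact ⟨hsub ω _ ha _ hab, hdisj ha hb⟩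
    have hvv'T : ω ∩ (↑T : Set (Sym2 V)) ∈ openConnIn U' v v' :=
      Percolation.BlockExploration.openConnIn_of_agree hvv' fun a ha b _ hab => hsub ω a ha b hab
    obtain ⟨p, -⟩ := Percolation.BlockExploration.exists_openWalk_of_mem_openConnIn hvv'T
    have h2 : (fromEdgeSet (ω ∩ (↑T : Set (Sym2 V)))).Reachable v v' := p.reachable
    exact (hadj hv hx hvx).symm.reachable.trans (h2.trans (hadj hv' hy hv'y).reachable)

end Literature.Probability.LatticeModels
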